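import Summits.AtomisticToContinuum.HydrodynamicLimit.Theorems.AntiMazurCoboundariesCellForecastPressureDecayEnskogObjects
import Literature.Analysis.FluidPDE.HardSphereCollisionRecord
import HarnessLib

/-!
# S2d · kinematic assembly, piece 8: displacement of a sphere of bounded speed
# (registered sub-goal `stub_kinematicAssembly_displacement` of stub `stub_kinematicAssembly`, crux line
# `enskog-compensator-martingale`, crux `CellForecastPressureDecay`, stmt-AtomisticToContinuum-13915)

To charge a collision cluster of the slab `[0, Δ]` to a STATIC event of the initial data (the error term of
`KinematicRates σ`, stub S2d), one needs that a sphere whose speed is `≤ V` on a window moves by at most `V` times the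
elapsed time — positions of a hard-sphere trajectory are continuous and piecewise free flights, but the velocity jumps
at the collisions, so this is a real-induction argument over the free stretches rather than a one-line integral. With
the speed bound of a collision-closed group (`stub_kinematicAssembly_clusterEnergy`, piece 7: `V = (∑_{q∈B} ‖v_q‖²)^{1/2}`)
it bounds the displacements inside a cluster by its initial energy.

* `norm_fst_sub_fst_le_of_norm_vel_le` — for a hard-sphere trajectory in `ℝᵈ`: speed of `p` at most `V` on `[a, b]`
  implies `‖x_p(t) − x_p(a)‖ ≤ V (t − a)` for `t ∈ [a, b]`;
* `stub_kinematicAssembly_displacement` (registered) — the same along the whole-cell flow of the line's objects.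

References: Gallagher–Saint-Raymond–Texier 2013, §4.1 (free flow between collisions, continuity of positions);
folklore (real induction).
-/

noncomputable section

open MeasureTheory ProbabilityTheory Set Filter Topology
open scoped ENNReal BigOperators InnerProductSpace
open Literature.Analysis.FluidPDE Literature.MathematicalPhysics.KineticTheory

namespace Summit.AtomisticToContinuum.HydrodynamicLimit.Theorems.EnskogCompensator

section Trajectory

variable {d : Type*} [Fintype d] {N : ℕ} {ε : ℝ} {γ : ℝ → Config N d (EuclideanSpace ℝ d)}

/-- **A sphere of speed `≤ V` on `[a, b]` moves by at most `V (t − a)` up to time `t ∈ [a, b]`** (hard-sphere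
trajectory in `ℝᵈ`; real induction over the free stretches, continuity of positions). [cite: GST2013, §4.1] -/
theorem norm_fst_sub_fst_le_of_norm_vel_le (h : IsHardSphereTrajectory (Euclidean.geometry d) ε N γ) {a b : ℝ}
    {p : Fin N} {V : ℝ} (hV : ∀ t ∈ Icc a b, ‖(γ t p).2‖ ≤ V) {t : ℝ} (ht : t ∈ Icc a b) :
    ‖(γ t p).1 - (γ a p).1‖ ≤ V * (t - a) := by
  let S : Set ℝ := {s | ‖(γ s p).1 - (γ a p).1‖ ≤ V * (s - a)}
  have hcont : Continuous fun s => ‖(γ s p).1 - (γ a p).1‖ := ((h.pos_continuous p).sub continuous_const).norm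
  have hclosed : IsClosed S := isClosed_le hcont (continuous_const.mul (continuous_id.sub continuous_const))
  have haS : a ∈ S := by
    show ‖(γ a p).1 - (γ a p).1‖ ≤ V * (a - a)
    rw [sub_self, norm_zero, sub_self, mul_zero]
  have key : Icc a b ⊆ S := by
    refine (hclosed.inter isClosed_Icc).Icc_subset_of_forall_mem_nhdsWithin haS ?_
    rintro x ⟨hxS, hxa, hxb⟩
    obtain ⟨u₀, hxu₀, hfree⟩ := h.exists_Ioo_right_free x
    have hVx : ‖(γ x p).2‖ ≤ V := hV x ⟨hxa, hxb.le⟩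
    filter_upwards [Ioo_mem_nhdsGT hxu₀] with y hy
    have hpos : (γ y p).1 = (γ x p).1 + (y - x) • (γ x p).2 := by
      rw [h.eq_freeFlight_of_Ioo_free hfree ⟨hy.1.le, hy.2⟩, freeFlight_apply, Euclidean.geometry_translate]
    have hstep : ‖(γ y p).1 - (γ x p).1‖ ≤ V * (y - x) := by
      rw [hpos, add_sub_cancel_left, norm_smul, Real.norm_of_nonneg (by linarith [hy.1]), mul_comm]
      exact mul_le_mul_of_nonneg_right hVx (by linarith [hy.1])
    show ‖(γ y p).1 - (γ a p).1‖ ≤ V * (y - a)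
    calc ‖(γ y p).1 - (γ a p).1‖ = ‖((γ y p).1 - (γ x p).1) + ((γ x p).1 - (γ a p).1)‖ := by
          rw [sub_add_sub_cancel]
      _ ≤ ‖(γ y p).1 - (γ x p).1‖ + ‖(γ x p).1 - (γ a p).1‖ := norm_add_le _ _
      _ ≤ V * (y - x) + V * (x - a) := add_le_add hstep hxS
      _ = V * (y - a) := by ring
  exact key ht

end Trajectory

/-! ## The registered sub-goal: the whole-cell Euclidean flow of the line -/

/-- **Registered sub-goal `stub_kinematicAssembly_displacement`** (piece of stub `stub_kinematicAssembly`, S2d, of the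
line `enskog-compensator-martingale`): along the whole-cell hard-sphere flow of a good initial datum, a sphere whose
speed is at most `V` on the window `[a, b]` is displaced by at most `V (t − a)` up to every time `t` of the window
(with piece 7 this bounds the displacements inside a collision cluster of the slab by its initial energy, the input of
the static charging of clusters). [cite: GST2013, §4.1] -/
theorem stub_kinematicAssembly_displacement : ∀ (σ : ℝ) (n : ℕ) (Ψ : Flows σ) (z : Cell n), z ∈ (Ψ n).good →
    ∀ (p : Fin n) (a b V : ℝ), (∀ t ∈ Set.Icc a b, ‖((Ψ n).flow t z p).2‖ ≤ V) →
      ∀ t ∈ Set.Icc a b, ‖((Ψ n).flow t z p).1 - ((Ψ n).flow a z p).1‖ ≤ V * (t - a) := by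
  intro σ n Ψ z hz p a b V hV t ht
  exact norm_fst_sub_fst_le_of_norm_vel_le ((Ψ n).isTrajectory z hz) hV ht

end Summit.AtomisticToContinuum.HydrodynamicLimit.Theorems.EnskogCompensator

end
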